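/-
Copyright (c) 2026. H413 campaign `hodgecm-mathlib`, squad K2, seat K2E1-p11 (gen 0).  Lane: `--supports stmt-HodgeConjecture-24833 --as helper` (count-neutral).
Deal (13)(i)∕(13′) of the dealer K2E1-plan (g6): the tile data `(νN, 𝓕)` of the constant-term bridge, in the shape K2-defs1's (ii) head consumes.
-/
import Summits.HodgeConjecture.HodgeConjecture.Theorems.K2E1TruncatedCuspConstantTermBridgeU2   -- ★ (this seat, p859247): `isFundamentalDomain_inv_two`, the bridge
import HarnessLib

/-!
# K1-L² for `U(1,1)`: the tile data `νN = n_* νV`, `𝓕 = (n(𝓕⁻))⁻¹` — Haar, right invariant, `N(F)`-fundamental, of mass `νV(𝓕⁻) ∉ {0, ∞}`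

sorry-free · THEOREMS ONLY · lane `--supports stmt-HodgeConjecture-24833 --as helper`.

The inputs `[νN.IsMulRightInvariant]`, `h𝓕 : IsFundamentalDomain N(F) 𝓕 νN`, `h𝓕₀ : νN 𝓕 ≠ 0`, `h𝓕top : νN 𝓕 ≠ ∞` of K2-defs1's every-rank cuspidality head
`ae_borelConstantTerm_indicator_comp_eq_zero_of_mem_HNcusp` (10:04:49Z bytes) FOR THE TILE DATA of ★ `K2E1TruncatedCuspConstantTermBridgeU2`
(`n = middleRootUnipotent`, Tate's `𝓕⁻ = traceZeroFundamentalDomain`): right invariance is ★ `isMulRightInvariant_of_isMulLeftInvariant_two` (abelian `N(𝔸_F)`); §2 `νN 𝓕 = νV 𝓕⁻` (inversion invariance ★, injectivity of the chart ★) hence `∉ {0, ∞}` (★ `measure_traceZeroFundamentalDomain_ne_zero_and_lt_top`);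
§3 `𝓕` is an `N(F)`-fundamental domain (★ `isFundamentalDomain_image_traceZeroFundamentalDomain_two` + ★ `isFundamentalDomain_inv_two`).
[cite: CasselsFrohlichANT1967, Ch. XV Thm. 4.1.3] [cite: Rogawski1990, §1.10]
-/

noncomputable section

set_option autoImplicit false

set_option linter.dupNamespace false

open NumberField IsDedekindDomain MeasureTheory Measure Set Function Filter Topology
open scoped NNReal MatrixGroups Pointwise ENNReal Classical

namespace Summit.HodgeConjecture.HodgeConjecture.Cruxes.H413.K2E1TruncatedCuspConstantTermTileDataU2

open Literature.NumberTheory.Automorphic Literature.NumberTheory.Automorphic.UnitaryGroup AdelicGroupData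
open Summit.HodgeConjecture.HodgeConjecture.Cruxes.H413.K2E1UnipotentHaarNormalisationU2 (isInvInvariant_of_isHaarMeasure_two)
open Summit.HodgeConjecture.HodgeConjecture.Cruxes.H413.K2E1TruncatedCuspConstantTermBridgeU2 (isFundamentalDomain_inv_two)

/-! ## The tile data of the CM pair (right invariance of a left-invariant measure on the abelian `N(𝔸_F)` is ★ `isMulRightInvariant_of_isMulLeftInvariant_two`) -/

section CM

variable (L : Type) [Field L] [NumberField L] [IsCMField L]
  (hij : (((0 : Fin 2) : Fin 2) : ℕ) + 1 = (((1 : Fin 2) : Fin 2) : ℕ)) (hN : 2 = 2 * (((0 : Fin 2) : Fin 2) : ℕ) + 2)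
  [MeasurableSpace (AdeleRing (𝓞 L) L)] [BorelSpace (AdeleRing (𝓞 L) L)]
  [MeasurableSpace ↥(adelicUnipotent (↥(maximalRealSubfield L)) L (IsCMField.complexConj L) 2)] [BorelSpace ↥(adelicUnipotent (↥(maximalRealSubfield L)) L (IsCMField.complexConj L) 2)]

/-- **`νN 𝓕 = νV 𝓕⁻`** for `νN = n_* νV`, `𝓕 = (n(𝓕⁻))⁻¹`: inversion invariance of the Haar measure `νN` (★) and injectivity of the chart (★ `MeasurableEmbedding.map_apply`).
[cite: CasselsFrohlichANT1967, Ch. XV Thm. 4.1.3 (2)] -/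
theorem map_chart_apply_tile (νV : Measure ↥(traceZeroAdele (↥(maximalRealSubfield L)) L (IsCMField.complexConj L))) [νV.IsAddHaarMeasure] :
    (νV.map (fun X : ↥(traceZeroAdele (↥(maximalRealSubfield L)) L (IsCMField.complexConj L)) => middleRootUnipotent hij hN (Multiplicative.ofAdd X))) (((fun X : ↥(traceZeroAdele (↥(maximalRealSubfield L)) L (IsCMField.complexConj L)) => middleRootUnipotent hij hN (Multiplicative.ofAdd X)) '' traceZeroFundamentalDomain (↥(maximalRealSubfield L)) L (IsCMField.complexConj L))⁻¹) = νV (traceZeroFundamentalDomain (↥(maximalRealSubfield L)) L (IsCMField.complexConj L)) := by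
  haveI : Algebra.IsQuadraticExtension ↥(maximalRealSubfield L) L := IsCMField.isQuadraticExtension L
  haveI := locallyCompactSpace_adeleRing' L
  haveI : (νV.map (fun X : ↥(traceZeroAdele (↥(maximalRealSubfield L)) L (IsCMField.complexConj L)) => middleRootUnipotent hij hN (Multiplicative.ofAdd X))).IsHaarMeasure := isHaarMeasure_map_middleRootUnipotent_two hij hN νV
  haveI : (νV.map (fun X : ↥(traceZeroAdele (↥(maximalRealSubfield L)) L (IsCMField.complexConj L)) => middleRootUnipotent hij hN (Multiplicative.ofAdd X))).IsInvInvariant := isInvInvariant_of_isHaarMeasure_two _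
  have hemb : MeasurableEmbedding (fun X : ↥(traceZeroAdele (↥(maximalRealSubfield L)) L (IsCMField.complexConj L)) => middleRootUnipotent hij hN (Multiplicative.ofAdd X)) := measurableEmbedding_middleRootUnipotent_two hij hN
  rw [measure_inv, hemb.map_apply, hemb.injective.preimage_image]

/-- **`νN 𝓕 ≠ 0`** (`= νV 𝓕⁻ > 0`, ★ `measure_traceZeroFundamentalDomain_ne_zero_and_lt_top`). [cite: CasselsFrohlichANT1967, Ch. XV Thm. 4.1.3] -/
theorem map_chart_apply_tile_ne_zero (νV : Measure ↥(traceZeroAdele (↥(maximalRealSubfield L)) L (IsCMField.complexConj L))) [νV.IsAddHaarMeasure] :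
    (νV.map (fun X : ↥(traceZeroAdele (↥(maximalRealSubfield L)) L (IsCMField.complexConj L)) => middleRootUnipotent hij hN (Multiplicative.ofAdd X))) (((fun X : ↥(traceZeroAdele (↥(maximalRealSubfield L)) L (IsCMField.complexConj L)) => middleRootUnipotent hij hN (Multiplicative.ofAdd X)) '' traceZeroFundamentalDomain (↥(maximalRealSubfield L)) L (IsCMField.complexConj L))⁻¹) ≠ 0 := by
  have hc : IsCMField.complexConj L * IsCMField.complexConj L = 1 := AlgEquiv.ext fun x => IsCMField.complexConj_apply_apply L x
  rw [map_chart_apply_tile L hij hN νV]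
  exact (measure_traceZeroFundamentalDomain_ne_zero_and_lt_top (F := ↥(maximalRealSubfield L)) (E := L) (c := IsCMField.complexConj L) hc νV).1

/-- **`νN 𝓕 ≠ ∞`** (`= νV 𝓕⁻ < ∞`, ★ `measure_traceZeroFundamentalDomain_ne_zero_and_lt_top`). [cite: CasselsFrohlichANT1967, Ch. XV Thm. 4.1.3] -/
theorem map_chart_apply_tile_ne_top (νV : Measure ↥(traceZeroAdele (↥(maximalRealSubfield L)) L (IsCMField.complexConj L))) [νV.IsAddHaarMeasure] :
    (νV.map (fun X : ↥(traceZeroAdele (↥(maximalRealSubfield L)) L (IsCMField.complexConj L)) => middleRootUnipotent hij hN (Multiplicative.ofAdd X))) (((fun X : ↥(traceZeroAdele (↥(maximalRealSubfield L)) L (IsCMField.complexConj L)) => middleRootUnipotent hij hN (Multiplicative.ofAdd X)) '' traceZeroFundamentalDomain (↥(maximalRealSubfield L)) L (IsCMField.complexConj L))⁻¹) ≠ ⊤ := by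
  have hc : IsCMField.complexConj L * IsCMField.complexConj L = 1 := AlgEquiv.ext fun x => IsCMField.complexConj_apply_apply L x
  rw [map_chart_apply_tile L hij hN νV]
  exact (measure_traceZeroFundamentalDomain_ne_zero_and_lt_top (F := ↥(maximalRealSubfield L)) (E := L) (c := IsCMField.complexConj L) hc νV).2.ne

/-- **`𝓕 = (n(𝓕⁻))⁻¹` is an `N(F)`-fundamental domain for `νN = n_* νV`** (★ `isFundamentalDomain_image_traceZeroFundamentalDomain_two`, ★ `isFundamentalDomain_inv_two`,
inversion invariance ★). [cite: CasselsFrohlichANT1967, Ch. XV Thm. 4.1.3 (1)] -/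
theorem isFundamentalDomain_tile (νV : Measure ↥(traceZeroAdele (↥(maximalRealSubfield L)) L (IsCMField.complexConj L))) [νV.IsAddHaarMeasure] :
    IsFundamentalDomain ↥(rationalUnipotent (↥(maximalRealSubfield L)) L (IsCMField.complexConj L) 2) (((fun X : ↥(traceZeroAdele (↥(maximalRealSubfield L)) L (IsCMField.complexConj L)) => middleRootUnipotent hij hN (Multiplicative.ofAdd X)) '' traceZeroFundamentalDomain (↥(maximalRealSubfield L)) L (IsCMField.complexConj L))⁻¹) (νV.map (fun X : ↥(traceZeroAdele (↥(maximalRealSubfield L)) L (IsCMField.complexConj L)) => middleRootUnipotent hij hN (Multiplicative.ofAdd X))) := by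
  have hc : IsCMField.complexConj L * IsCMField.complexConj L = 1 := AlgEquiv.ext fun x => IsCMField.complexConj_apply_apply L x
  haveI : Algebra.IsQuadraticExtension ↥(maximalRealSubfield L) L := IsCMField.isQuadraticExtension L
  haveI := locallyCompactSpace_adeleRing' L
  haveI : (νV.map (fun X : ↥(traceZeroAdele (↥(maximalRealSubfield L)) L (IsCMField.complexConj L)) => middleRootUnipotent hij hN (Multiplicative.ofAdd X))).IsHaarMeasure := isHaarMeasure_map_middleRootUnipotent_two hij hN νV
  haveI : (νV.map (fun X : ↥(traceZeroAdele (↥(maximalRealSubfield L)) L (IsCMField.complexConj L)) => middleRootUnipotent hij hN (Multiplicative.ofAdd X))).IsInvInvariant := isInvInvariant_of_isHaarMeasure_two _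
  exact isFundamentalDomain_inv_two (isFundamentalDomain_image_traceZeroFundamentalDomain_two hij hN hc _)

/-- **`νN = n_* νV` is right invariant** (§1; it is Haar ★ `isHaarMeasure_map_middleRootUnipotent_two`). [cite: Rogawski1990, §1.10] -/
theorem isMulRightInvariant_map_chart (νV : Measure ↥(traceZeroAdele (↥(maximalRealSubfield L)) L (IsCMField.complexConj L))) [νV.IsAddHaarMeasure] : (νV.map (fun X : ↥(traceZeroAdele (↥(maximalRealSubfield L)) L (IsCMField.complexConj L)) => middleRootUnipotent hij hN (Multiplicative.ofAdd X))).IsMulRightInvariant := by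
  haveI : Algebra.IsQuadraticExtension ↥(maximalRealSubfield L) L := IsCMField.isQuadraticExtension L
  haveI := locallyCompactSpace_adeleRing' L
  haveI : (νV.map (fun X : ↥(traceZeroAdele (↥(maximalRealSubfield L)) L (IsCMField.complexConj L)) => middleRootUnipotent hij hN (Multiplicative.ofAdd X))).IsHaarMeasure := isHaarMeasure_map_middleRootUnipotent_two hij hN νV
  exact isMulRightInvariant_of_isMulLeftInvariant_two (F := ↥(maximalRealSubfield L)) (E := L) (c := IsCMField.complexConj L) _

end CM

end Summit.HodgeConjecture.HodgeConjecture.Cruxes.H413.K2E1TruncatedCuspConstantTermTileDataU2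

end
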